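import Mathlib
import Summits.NavierStokesRegularity.NavierStokesRegularity.Theorems.L3TimeExponentPincerSubparabolicFifthNode
import Summits.NavierStokesRegularity.NavierStokesRegularity.Theorems.L3TimeExponentPincerSmoothBranch
import HarnessLib.Audit
import HarnessLib

/-!
# The SUB-PARABOLIC coupled clock as a by-name node of the jaw
# (route `L3TimeExponentPincer`, crux `L3CascadeJaw`, stmt-NavierStokesRegularity-19499; nsreg-p2 ROUND-11/12 seed s3)

Support file for the parent crux `L3CascadeJaw` (cell ns-regularity-ideate, seat nsreg-p4 gen 6).  THEOREM J‴
(`…SubparabolicMorreyJaw`, `…SubparabolicMorreyRate`, nsreg-p4 g5) showed that only the SUB-parabolic radii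
`r ≤ √(T-t)` of the scaled energy enter the jaw, at the price of a gradient-free remainder clock `Φ/(T-t)`:
`jaw_of_coupledSubparabolic` — `∫ (Φ δ)^{q/6} < ∞` and `∫ (Φ/(T-t))^{q/6} < ∞` give `u ∈ L^q_t L³_x`.  The planner's
ROUND-11 seed asked for the corresponding BY-NAME node; as recorded on STATUS (nsreg-p4 g6 13:53Z) it is NOT a
weakening of the all-radii coupled node `AllBlowupsCoupledClockB` (the remainder clock needs integrability of `Φ`
alone), so it is typed here as a SEPARATE node with its own arrows:

* `AllBlowupsCoupledClockSubB` (`@[conjecture]`, OPEN) — every frame blow-up admits a measurable sub-parabolic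
  Morrey-rate majorant `Φ` (`SubparabolicMorreyRateNear u T Φ`) whose two clocks `(Φδ)^s` and `(Φ/(T-t))^s` are
  integrable near `T` for every `0 ≤ s < 5/6`;
* `l3CascadeJaw_of_allBlowupsCoupledClockSubB : AllBlowupsCoupledClockSubB → L3CascadeJaw` (crux BY NAME; smooth
  branch `jawSmoothBranch_holds`, blow-up branch `jaw_of_coupledSubparabolic` at `s = q/6 ∈ (2/3, 5/6)`);
* `clocks_of_subparabolicPowerRate` — a sub-parabolic power rate `M (T-t)^{-β}` runs both clocks for every
  `0 ≤ s` with `s (1+β) < 1` and `s < 1` (Young for clock 1, pure power for clock 2; the computation of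
  `jaw_of_subparabolicMorreyPowerRate`, exposed at the clock level);
* `allBlowupsCoupledClockSubB_of_subparabolicFifthB : AllBlowupsSubparabolicFifthB → AllBlowupsCoupledClockSubB`
  (`β = 1/5`: `s (1 + 1/5) < 1 ⇔ s < 5/6`), hence `…_of_fullMorreyB`, `…_of_noTypeII`: the by-name web now reads
  `NoTypeII ⇒ FullMorreyB ⇒ SubparabolicFifthB ⇒ CoupledClockSubB ⇒ L3CascadeJaw` on the sub-parabolic side, beside
  `FullMorreyB ⇒ CoupledClockB ⇐ DissipationFiveFourths` on the all-radii side (`…SobolevMajorant`); the two coupled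
  nodes are not known to be comparable.

Calibration (docstrings only, nsreg-p2 STATUS 12:16Z): on the Euler-speed cascade `Φ_sub ≍ (T-t)^{-1/5}`,
`Φ_sub δ ≍ (T-t)^{-1}`, remainder `Φ_sub/(T-t) ≍ (T-t)^{-6/5}` — the remainder clock carries the border `s < 5/6`
(`q < 5`), as it must.
WHAT THIS IS NOT: not a claim about Navier–Stokes regularity or blow-up; no item is closed; the node is a typed
hypothesis (open), the arrows are kernel theorems.
-/

noncomputable section

namespace Summit.NavierStokesRegularity.NavierStokesRegularity.Theorems.L3TimeExponentPincerCoupledClockSub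

open MeasureTheory Set Function Filter Metric Topology
open scoped ENNReal NNReal
open Literature.Analysis.FluidPDE
open Summit.NavierStokesRegularity.NavierStokesRegularity.Theorems.L3TimeExponentPincerJawFullMorrey
  (dissipRate dissip_lt_top AllBlowupsFullMorreyB)
open Summit.NavierStokesRegularity.NavierStokesRegularity.Theorems.L3TimeExponentPincerJawMorreyRate
  (div_ofReal_le_self lintegral_Ioo_rpow_neg_lt_top)
open Summit.NavierStokesRegularity.NavierStokesRegularity.Theorems.L3TimeExponentPincerSubparabolicMorreyRate
  (SubparabolicMorreyRateNear jaw_of_coupledSubparabolic)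
open Summit.NavierStokesRegularity.NavierStokesRegularity.Theorems.L3TimeExponentPincerSubparabolicFifthNode
  (AllBlowupsSubparabolicFifthB allBlowupsSubparabolicFifthB_of_allBlowupsFullMorreyB allBlowupsSubparabolicFifthB_of_noTypeII)
open Summit.NavierStokesRegularity.NavierStokesRegularity.Theses.L3TimeExponentPincer (L3CascadeJaw)

/-! ## §1  The node and the crux by name -/

/-- **The sub-parabolic coupled-clock node** (OPEN; a typed hypothesis): every frame blow-up admits a measurable
sub-parabolic Morrey-rate majorant `Φ` (`∫_{B(x,r)} |u(t)|² ≤ Φ(t) r` for late `t`, all `x`, all `0 < r ≤ √(T-t)`)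
whose coupled clock `(Φ δ)^s` and remainder clock `(Φ/(T-t))^s` are both integrable near `T` for every
`0 ≤ s < 5/6`.  Implied by `AllBlowupsSubparabolicFifthB` (hence by `AllBlowupsFullMorreyB`, `NoTypeII`). -/
@[conjecture] def AllBlowupsCoupledClockSubB : Prop :=
  ∀ (ν T : ℝ), 0 < ν → 0 < T →
    ∀ (u : ℝ → (EuclideanSpace ℝ (Fin 3)) → (EuclideanSpace ℝ (Fin 3))) (p : ℝ → (EuclideanSpace ℝ (Fin 3)) → ℝ),
    IsClassicalNSSolutionOn (Ico 0 T) ν 0 u p → IsLerayHopfOn T ν 0 (u 0) u →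
    HasRapidSpatialDecay (u 0) → ¬ HasSmoothExtensionPast ν 0 u T →
    ∃ Φ : ℝ → ℝ≥0, Measurable Φ ∧ SubparabolicMorreyRateNear u T Φ ∧ ∀ s : ℝ, 0 ≤ s → s < 5 / 6 →
      (∃ T₁ < T, ∫⁻ t in Ioo T₁ T, ((Φ t : ℝ≥0∞) * dissipRate u t) ^ s < ⊤) ∧
      (∃ T₁ < T, ∫⁻ t in Ioo T₁ T, ((Φ t : ℝ≥0∞) * ENNReal.ofReal ((T - t)⁻¹)) ^ s < ⊤)

/-- **The parent crux BY NAME through the sub-parabolic coupled clock**: `AllBlowupsCoupledClockSubB ⇒ L3CascadeJaw`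
(`stmt-NavierStokesRegularity-19499`); smooth branch = `jawSmoothBranch_holds`, blow-up branch =
`jaw_of_coupledSubparabolic` at `s = q/6 ∈ (2/3, 5/6)`. -/
theorem l3CascadeJaw_of_allBlowupsCoupledClockSubB (hA : AllBlowupsCoupledClockSubB) : L3CascadeJaw := by
  intro q hq4 hq5 ν T hν hT u p hcl hLH hdec
  by_cases hext : HasSmoothExtensionPast ν 0 u T
  · exact Summit.NavierStokesRegularity.NavierStokesRegularity.Theorems.L3TimeExponentPincerSmoothBranch.jawSmoothBranch_holds
      q hq4 hq5 ν T hν hT u p hcl hLH hdec hext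
  · obtain ⟨Φ, hΦm, hS, hclocks⟩ := hA ν T hν hT u p hcl hLH hdec hext
    obtain ⟨h1, h2⟩ := hclocks (q / 6) (by positivity) (by linarith)
    exact jaw_of_coupledSubparabolic hν hT hcl hLH hΦm hS (by linarith) (by linarith) h1 h2

/-! ## §2  Power rates run both clocks -/

/-- **A sub-parabolic power rate runs both clocks.**  For a classical solution on `[0,T)`, Leray–Hopf from `u 0`,
and the rate function `Φ(t) = M (T-t)^{-β}` (`M ≥ 0`): for every exponent `0 ≤ s < 1` with `s (1+β) < 1`,
`∫_{T₁}^{T} (Φ δ)^s < ∞` (Young: `(Φδ)^s ≤ Φ^{s/(1-s)} + δ`, `Φ^{s/(1-s)} ≍ (T-t)^{-βs/(1-s)}`, exponent `< 1` iff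
`s(1+β) < 1`) and `∫_{T₁}^{T} (Φ/(T-t))^s < ∞` (`≍ (T-t)^{-(1+β)s}`). -/
theorem clocks_of_subparabolicPowerRate {ν T : ℝ} (hT : 0 < T)
    {u : ℝ → (EuclideanSpace ℝ (Fin 3)) → (EuclideanSpace ℝ (Fin 3))} {p : ℝ → (EuclideanSpace ℝ (Fin 3)) → ℝ}
    (hcl : IsClassicalNSSolutionOn (Ico 0 T) ν 0 u p) (hLH : IsLerayHopfOn T ν 0 (u 0) u)
    {M β : ℝ} (hM : 0 ≤ M) {T₁ : ℝ} (hT₁ : T₁ < T) {s : ℝ} (hs0 : 0 ≤ s) (hs1 : s < 1)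
    (hsβ : s * (1 + β) < 1) :
    (∫⁻ t in Ioo (max T₁ 0) T,
        (((fun t => (M * (T - t) ^ (-β)).toNNReal : ℝ → ℝ≥0) t : ℝ≥0∞) * dissipRate u t) ^ s < ⊤) ∧
    (∫⁻ t in Ioo T₁ T,
        (((fun t => (M * (T - t) ^ (-β)).toNNReal : ℝ → ℝ≥0) t : ℝ≥0∞) * ENNReal.ofReal ((T - t)⁻¹)) ^ s < ⊤) := by
  set Φ : ℝ → ℝ≥0 := fun t => (M * (T - t) ^ (-β)).toNNReal with hΦ
  have hΦeq : ∀ t, t < T → (Φ t : ℝ) = M * (T - t) ^ (-β) := fun t ht =>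
    Real.coe_toNNReal _ (mul_nonneg hM (Real.rpow_nonneg (sub_pos.2 ht).le _))
  refine ⟨?_, ?_⟩
  · -- clock 1
    rcases eq_or_lt_of_le hs0 with h0 | hs0'
    · -- `s = 0`: the integrand is `1` on a bounded window
      rw [← h0]
      simp only [ENNReal.rpow_zero]
      rw [setLIntegral_const, Real.volume_Ioo]
      exact ENNReal.mul_lt_top ENNReal.one_lt_top ENNReal.ofReal_lt_top
    · -- Young with conjugate exponents `1/(1-s)` and `1/s`
      have hα : 0 < 1 - s := by linarith
      have hconj : (1 / (1 - s)).HolderConjugate (1 / s) := Real.holderConjugate_one_div hα hs0' (by ring)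
      have hp1 : 1 ≤ 1 / (1 - s) := one_le_one_div hα (by linarith)
      have hp2 : 1 ≤ 1 / s := one_le_one_div hs0' hs1.le
      set γ₁ : ℝ := β * (s / (1 - s)) with hγ₁
      have hγ₁1 : γ₁ < 1 := by
        rw [hγ₁, ← mul_div_assoc, div_lt_one hα]
        nlinarith
      have hpt : ∀ t ∈ Ioo (max T₁ 0) T, ((Φ t : ℝ≥0∞) * dissipRate u t) ^ s ≤
          ENNReal.ofReal (M ^ (s / (1 - s)) * (T - t) ^ (-γ₁)) + dissipRate u t := by
        intro t ht
        have hst : 0 < T - t := sub_pos.2 ht.2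
        rw [ENNReal.mul_rpow_of_nonneg _ _ hs0]
        have hY := ENNReal.young_inequality ((Φ t : ℝ≥0∞) ^ s) ((dissipRate u t) ^ s) hconj
        have hA : (((Φ t : ℝ≥0∞) ^ s) ^ (1 / (1 - s))) = ENNReal.ofReal (M ^ (s / (1 - s)) * (T - t) ^ (-γ₁)) := by
          rw [← ENNReal.rpow_mul, show s * (1 / (1 - s)) = s / (1 - s) by field_simp,
            ← ENNReal.ofReal_coe_nnreal, hΦeq t ht.2,
            ENNReal.ofReal_rpow_of_nonneg (mul_nonneg hM (Real.rpow_nonneg hst.le _)) (by positivity),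
            Real.mul_rpow hM (Real.rpow_nonneg hst.le _), ← Real.rpow_mul hst.le, hγ₁]
          congr 3
          ring
        have hD : ((dissipRate u t) ^ s) ^ (1 / s) = dissipRate u t := by
          rw [← ENNReal.rpow_mul, show s * (1 / s) = 1 by field_simp, ENNReal.rpow_one]
        calc (Φ t : ℝ≥0∞) ^ s * (dissipRate u t) ^ s ≤ _ := hY
          _ ≤ ((Φ t : ℝ≥0∞) ^ s) ^ (1 / (1 - s)) + ((dissipRate u t) ^ s) ^ (1 / s) :=
              add_le_add (div_ofReal_le_self _ hp1) (div_ofReal_le_self _ hp2)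
          _ = _ := by rw [hA, hD]
      have hmeas : Measurable fun t : ℝ => ENNReal.ofReal (M ^ (s / (1 - s)) * (T - t) ^ (-γ₁)) :=
        (measurable_const.mul ((measurable_const.sub measurable_id).pow_const _)).ennreal_ofReal
      have hdiss : ∫⁻ t in Ioo (max T₁ 0) T, dissipRate u t < ⊤ :=
        lt_of_le_of_lt (lintegral_mono_set (Ioo_subset_Ioo_left (le_max_right _ _))) (dissip_lt_top hcl hLH)
      calc ∫⁻ t in Ioo (max T₁ 0) T, ((Φ t : ℝ≥0∞) * dissipRate u t) ^ s
          ≤ ∫⁻ t in Ioo (max T₁ 0) T, (ENNReal.ofReal (M ^ (s / (1 - s)) * (T - t) ^ (-γ₁)) + dissipRate u t) :=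
            setLIntegral_mono' measurableSet_Ioo hpt
        _ = (∫⁻ t in Ioo (max T₁ 0) T, ENNReal.ofReal (M ^ (s / (1 - s)) * (T - t) ^ (-γ₁))) +
              ∫⁻ t in Ioo (max T₁ 0) T, dissipRate u t := lintegral_add_left hmeas _
        _ < ⊤ := ENNReal.add_lt_top.2 ⟨lintegral_Ioo_rpow_neg_lt_top (max_lt hT₁ hT) hγ₁1, hdiss⟩
  · -- clock 2: pure power `(T-t)^{-(1+β)s}`
    set γ₂ : ℝ := (1 + β) * s with hγ₂
    have hγ₂1 : γ₂ < 1 := by rw [hγ₂]; nlinarith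
    have hpt : ∀ t ∈ Ioo T₁ T, ((Φ t : ℝ≥0∞) * ENNReal.ofReal ((T - t)⁻¹)) ^ s =
        ENNReal.ofReal (M ^ s * (T - t) ^ (-γ₂)) := by
      intro t ht
      have hst : 0 < T - t := sub_pos.2 ht.2
      rw [← ENNReal.ofReal_coe_nnreal, hΦeq t ht.2, ← ENNReal.ofReal_mul (mul_nonneg hM (Real.rpow_nonneg hst.le _)),
        ENNReal.ofReal_rpow_of_nonneg (by positivity) hs0,
        show M * (T - t) ^ (-β) * (T - t)⁻¹ = M * ((T - t) ^ (-β) * (T - t) ^ (-1 : ℝ)) by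
          rw [Real.rpow_neg_one]; ring,
        ← Real.rpow_add hst, Real.mul_rpow hM (Real.rpow_nonneg hst.le _), ← Real.rpow_mul hst.le, hγ₂]
      congr 3
      ring
    calc ∫⁻ t in Ioo T₁ T, ((Φ t : ℝ≥0∞) * ENNReal.ofReal ((T - t)⁻¹)) ^ s
        = ∫⁻ t in Ioo T₁ T, ENNReal.ofReal (M ^ s * (T - t) ^ (-γ₂)) := setLIntegral_congr_fun measurableSet_Ioo hpt
      _ < ⊤ := lintegral_Ioo_rpow_neg_lt_top hT₁ hγ₂1

/-! ## §3  The arrows into the node -/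

/-- **`AllBlowupsSubparabolicFifthB ⇒ AllBlowupsCoupledClockSubB`**: the power rate `M (T-t)^{-1/5}` is a measurable
sub-parabolic majorant and runs both clocks for every `s < 5/6` (`s (1 + 1/5) < 1`). -/
theorem allBlowupsCoupledClockSubB_of_subparabolicFifthB (hA : AllBlowupsSubparabolicFifthB) :
    AllBlowupsCoupledClockSubB := by
  intro ν T hν hT u p hcl hLH hdec hext
  obtain ⟨M, hM, T₁, hT₁, hrate⟩ := hA ν T hν hT u p hcl hLH hdec hext
  set Φ : ℝ → ℝ≥0 := fun t => (M * (T - t) ^ (-(1 / 5 : ℝ))).toNNReal with hΦ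
  have hΦm : Measurable Φ :=
    (measurable_const.mul ((measurable_const.sub measurable_id).pow_const _)).real_toNNReal
  have hΦeq : ∀ t, t < T → (Φ t : ℝ) = M * (T - t) ^ (-(1 / 5 : ℝ)) := fun t ht =>
    Real.coe_toNNReal _ (mul_nonneg hM (Real.rpow_nonneg (sub_pos.2 ht).le _))
  have hS : SubparabolicMorreyRateNear u T Φ :=
    ⟨T₁, hT₁, fun t ht x₀ r hr hrs => by rw [hΦeq t ht.2]; exact hrate t ht x₀ r hr hrs⟩
  refine ⟨Φ, hΦm, hS, fun s hs0 hs => ?_⟩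
  obtain ⟨h1, h2⟩ := clocks_of_subparabolicPowerRate (β := 1 / 5) hT hcl hLH hM hT₁ hs0 (by linarith) (by nlinarith)
  exact ⟨⟨max T₁ 0, max_lt hT₁ hT, h1⟩, ⟨T₁, hT₁, h2⟩⟩

/-- `AllBlowupsFullMorreyB ⇒ AllBlowupsCoupledClockSubB` (through `AllBlowupsSubparabolicFifthB`). -/
theorem allBlowupsCoupledClockSubB_of_fullMorreyB (hA : AllBlowupsFullMorreyB) : AllBlowupsCoupledClockSubB :=
  allBlowupsCoupledClockSubB_of_subparabolicFifthB (allBlowupsSubparabolicFifthB_of_allBlowupsFullMorreyB hA)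

/-- The ladder's top: hard core `NoTypeII` (`stmt-NavierStokesRegularity-0056`) ⇒ the node. -/
theorem allBlowupsCoupledClockSubB_of_noTypeII
    (h : Summit.NavierStokesRegularity.NavierStokesRegularity.Theses.TypeICertificateLadder.NoTypeII) :
    AllBlowupsCoupledClockSubB :=
  allBlowupsCoupledClockSubB_of_subparabolicFifthB (allBlowupsSubparabolicFifthB_of_noTypeII h)

end Summit.NavierStokesRegularity.NavierStokesRegularity.Theorems.L3TimeExponentPincerCoupledClockSub

end
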